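import Mathlib
import Summits.ValiantsHypothesis.ValiantsHypothesis.Theorems.NewtonTauWeak.Negative.Zonogon

/-!
# `NewtonTauWeak` (stmt-ValiantsHypothesis-5904), line `binomial-normal-form`: coincidences push the
# cancellation depth of three binomial products beyond the dissociated thickness bound

Support file for the crux
`Summit.ValiantsHypothesis.ValiantsHypothesis.Theses.NewtonUnitEquations.NewtonTauWeak`
(KPTT arXiv:1308.2286, Conjecture 1 in the weak form of their Theorem 1), open stub
`stub_binomialNewtonTauCommon` (KPTT Conj. 1 at `t = 2`, common exponent list, coincidences allowed).

The fixed-`K` engine of the route (`DissociatedFixedK`, stmt-5907, PROVED) rests on THICKNESS: when the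
subset-sum map of the exponent list is injective, the `w`-extreme surviving word of
`Σ_{l<K} c_l Π_j (1 - ρ_{lj} X^{d_j})` differs from the `w`-extreme word of the frame in `< K` letters
(`Theorems/NewtonUnitEquationsDissociatedFixedKThickness.lean`, `stub_thicknessFit`, whose hypothesis
`htop` is about TENSOR values of words, not about coefficients of lattice points).  This file records the
smallest instance showing that the letter count `< K` is FALSE for coefficients once subset sums coincide:
with `K = 3` products of `N = 4` binomials over the common exponent list
`d = ((1,0), (1,1), (1,1), (1,2))` (one repeated exponent, and the coincidence `(1,0)+(1,2) = (1,1)+(1,1)`),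

  `(1 + 2XY)(1 - XY) + (1 + 2X)(1 + XY)(1 + 2XY²) - 2·(1 + X)(1 + XY)(1 + XY²) = 2·X³Y³`

(`coincidenceDepth_identity`, `coincidenceDepth_sum_eq`): every product is alive at the corner `0`
(all factors have constant term `1`), the whole sum collapses to ONE monomial, and that monomial's
exponent `(3,3)` is reached only by words of `3 = K` letters (`card_eq_three_of_sum_eq`).  So for every
direction `w` making the corner `0` the `w`-bottom of the frame, the bottom survivor sits at letter
distance `K`, not `< K`: the cancelled lattice point `(2,2)` carries the NONZERO tensor value of the word
`{(1,0),(1,2)}` (namely `Σ_l c_l ρ_{l0} ρ_{l3} = 4 - 2 = 2`), killed only inside its fibre by the word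
`{(1,1),(1,1)'}`.  Consequences for the line (lead c2, NOTES §8 of `Cruxes/NewtonTauWeak/NOTES.md`):
a fixed-`K` bound in the coincidence regime cannot come from letter-thickness; the replacement
conjectured there is DIRECTION-thickness (`≤ K-1` distinct directions, multiplicities `≤ K·deg`), which
this instance satisfies (`(3,3) = 3·(1,1)`).

Main results: `coincidenceDepth_identity`, `coincidenceDepth_sum_eq`, `card_eq_three_of_sum_eq`,
`vert_coincidenceDepth_le_one`.  No definitions (the instance data are literals in every statement),
no named facts; everything is `ring`/`simp`-level.

References: KPTT arXiv:1308.2286 Conj. 1, §2 (cancellations as "the main difficulty"); the instance is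
new bookkeeping for this line [folklore-level algebra].
-/

-- the namespace mandated for this Theorems file repeats the component `ValiantsHypothesis`
set_option linter.dupNamespace false

noncomputable section

open scoped BigOperators
open MvPolynomial
open Summit.ValiantsHypothesis.ValiantsHypothesis.Theorems.NewtonTauWeak.Negative (vert vert_le_card_support)

namespace Summit.ValiantsHypothesis.ValiantsHypothesis.Theorems.NewtonUnitEquationsNewtonTauWeak

namespace CoincidenceDepth

/-- **The identity.** Three products of binomials, all alive at the corner, summing to a single monomial
at letter distance `3`:
`(1 + 2XY)(1 - XY) + (1 + 2X)(1 + XY)(1 + 2XY²) - 2(1 + X)(1 + XY)(1 + XY²) = 2X³Y³`. [folklore] -/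
theorem coincidenceDepth_identity :
    ((1 + 2 * (X 0 * X 1)) * (1 - X 0 * X 1)
      + (1 + 2 * X 0) * (1 + X 0 * X 1) * (1 + 2 * (X 0 * X 1 ^ 2))
      - 2 * ((1 + X 0) * (1 + X 0 * X 1) * (1 + X 0 * X 1 ^ 2)) : MvPolynomial (Fin 2) ℂ)
      = 2 * (X 0 ^ 3 * X 1 ^ 3) := by
  ring

/-! The data of the instance are written as LITERALS in every statement (no definitions, no notation):
the common exponent list `d = ((1,0), (1,1), (1,1), (1,2))` (the exponent `(1,1)` repeated) is
`![single 0 1, single 0 1 + single 1 1, single 0 1 + single 1 1, single 0 1 + single 1 2]`, the scalars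
`c = (1, 1, -2)` are `![1, 1, -2]`, and the binomial coefficients `ρ_{lj}` (`ρ = 0` pads with a factor `1`;
product 0 = `(1 + 2XY)(1 - XY)`, product 1 = `(1 + 2X)(1 + XY)(1 + 2XY²)`, product 2 =
`(1 + X)(1 + XY)(1 + XY²)`) are `![![0, -2, 1, 0], ![-2, -1, 0, -2], ![-1, -1, 0, -1]]`. -/

/-- Monomials of the exponent list as products of variables. [folklore] -/
theorem monomial_single_add_single (a b : ℕ) :
    (monomial (Finsupp.single 0 a + Finsupp.single 1 b) (1 : ℂ) : MvPolynomial (Fin 2) ℂ)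
      = X 0 ^ a * X 1 ^ b := by
  rw [X_pow_eq_monomial, X_pow_eq_monomial, monomial_mul, one_mul]

/-- **The identity in the shape of the open stub** (`K = 3`, `N = 4`, common exponent list `((1,0),(1,1),(1,1),(1,2))`):
`Σ_{l<3} C(c_l) · Π_{j<4} (1 - C(ρ_{lj}) · X^{d_j}) = 2 · X^{(3,3)}`. [folklore] -/
theorem coincidenceDepth_sum_eq :
    (∑ l : Fin 3, C ((![1, 1, -2] : Fin 3 → ℂ) l) * ∏ j : Fin 4,
        (1 - C ((![![0, -2, 1, 0], ![-2, -1, 0, -2], ![-1, -1, 0, -1]] : Fin 3 → Fin 4 → ℂ) l j)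
          * monomial ((![Finsupp.single 0 1, Finsupp.single 0 1 + Finsupp.single 1 1,
      Finsupp.single 0 1 + Finsupp.single 1 1, Finsupp.single 0 1 + Finsupp.single 1 2] : Fin 4 → (Fin 2 →₀ ℕ)) j) (1 : ℂ)) : MvPolynomial (Fin 2) ℂ)
      = monomial (Finsupp.single 0 3 + Finsupp.single 1 3) 2 := by
  have h2 : (monomial (Finsupp.single 0 3 + Finsupp.single 1 3) (2 : ℂ) : MvPolynomial (Fin 2) ℂ)
      = 2 * (X 0 ^ 3 * X 1 ^ 3) := by
    rw [← monomial_single_add_single, ← map_ofNat C 2, C_mul_monomial, mul_one]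
  rw [h2, ← coincidenceDepth_identity]
  simp only [Fin.sum_univ_three, Fin.prod_univ_four, Matrix.cons_val_zero,
    Matrix.cons_val_one, Matrix.head_cons, Matrix.cons_val_two, Matrix.tail_cons,
    Matrix.cons_val_three]
  have e10 : (monomial (Finsupp.single (0 : Fin 2) 1) (1 : ℂ) : MvPolynomial (Fin 2) ℂ) = X 0 := by
    rw [X]
  have e11 : (monomial (Finsupp.single (0 : Fin 2) 1 + Finsupp.single 1 1) (1 : ℂ) : MvPolynomial (Fin 2) ℂ)
      = X 0 * X 1 := by
    rw [monomial_single_add_single, pow_one, pow_one]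
  have e12 : (monomial (Finsupp.single (0 : Fin 2) 1 + Finsupp.single 1 2) (1 : ℂ) : MvPolynomial (Fin 2) ℂ)
      = X 0 * X 1 ^ 2 := by
    rw [monomial_single_add_single, pow_one]
  rw [e10, e11, e12]
  simp only [map_zero, map_one, map_neg, map_ofNat, zero_mul, sub_zero]
  ring

/-- **Letter distance.** Every word of the frame `((1,0),(1,1),(1,1),(1,2))` summing to the surviving exponent `(3,3)` has
exactly `3` letters (the words are `{0,1,3}` and `{0,2,3}`); in particular no word of `< K = 3` letters
reaches it, although every product is alive at the corner. [folklore] -/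
theorem card_eq_three_of_sum_eq (J : Finset (Fin 4))
    (hJ : ∑ j ∈ J, (![Finsupp.single 0 1, Finsupp.single 0 1 + Finsupp.single 1 1,
      Finsupp.single 0 1 + Finsupp.single 1 1, Finsupp.single 0 1 + Finsupp.single 1 2] : Fin 4 → (Fin 2 →₀ ℕ)) j
      = Finsupp.single 0 3 + Finsupp.single 1 3) : J.card = 3 := by
  -- every exponent of the list has first coordinate `1`, so the first coordinate of a subset sum
  -- is the number of letters
  have h0 := congrArg (fun e : Fin 2 →₀ ℕ => e 0) hJ
  have hd : ∀ c : Fin 4, ((![Finsupp.single 0 1, Finsupp.single 0 1 + Finsupp.single 1 1,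
      Finsupp.single 0 1 + Finsupp.single 1 1, Finsupp.single 0 1 + Finsupp.single 1 2] : Fin 4 → (Fin 2 →₀ ℕ)) c) 0 = 1 := by
    intro c
    fin_cases c <;> simp
  simp only [Finsupp.coe_finsetSum, Finset.sum_apply, Finsupp.coe_add, Pi.add_apply, hd,
    Finset.sum_const, smul_eq_mul, mul_one, Finsupp.single_apply] at h0
  simpa using h0

/-- **All three products are alive at the corner**: every factor `1 - C(ρ_{lj}) X^{d_j}` has constant
coefficient `1` (no exponent `d_j` is `0`). [folklore] -/
theorem coeff_zero_factor (l : Fin 3) (j : Fin 4) :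
    coeff 0 (1 - C ((![![0, -2, 1, 0], ![-2, -1, 0, -2], ![-1, -1, 0, -1]] : Fin 3 → Fin 4 → ℂ) l j)
      * monomial ((![Finsupp.single 0 1, Finsupp.single 0 1 + Finsupp.single 1 1,
      Finsupp.single 0 1 + Finsupp.single 1 1, Finsupp.single 0 1 + Finsupp.single 1 2] : Fin 4 → (Fin 2 →₀ ℕ)) j) (1 : ℂ) : MvPolynomial (Fin 2) ℂ) = 1 := by
  have hd : (![Finsupp.single 0 1, Finsupp.single 0 1 + Finsupp.single 1 1,
      Finsupp.single 0 1 + Finsupp.single 1 1, Finsupp.single 0 1 + Finsupp.single 1 2] : Fin 4 → (Fin 2 →₀ ℕ)) j ≠ 0 := by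
    intro h
    have := congrArg (fun e : Fin 2 →₀ ℕ => e 0) h
    fin_cases j <;> simp at this
  rw [coeff_sub, coeff_one, if_pos rfl, C_mul_monomial, mul_one, coeff_monomial, if_neg hd, sub_zero]

/-- **The tensor value of the cancelled `2`-letter word `{0,3}` is nonzero** (`Σ_l c_l ρ_{l0} ρ_{l3} = 2`):
the lattice point `(2,2) = d_0 + d_3 = d_1 + d_2` dies only through its fibre, which is exactly what the
dissociated thickness hypothesis (`htop` of `stub_thicknessFit`) excludes. [folklore] -/
theorem tensor_word03_ne_zero :
    (∑ l : Fin 3, (![1, 1, -2] : Fin 3 → ℂ) l * ((![![0, -2, 1, 0], ![-2, -1, 0, -2], ![-1, -1, 0, -1]] : Fin 3 → Fin 4 → ℂ) l 0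
      * (![![0, -2, 1, 0], ![-2, -1, 0, -2], ![-1, -1, 0, -1]] : Fin 3 → Fin 4 → ℂ) l 3)) ≠ 0 := by
  simp only [Fin.sum_univ_three, Matrix.cons_val_zero, Matrix.cons_val_one,
    Matrix.head_cons, Matrix.cons_val_two, Matrix.tail_cons, Matrix.cons_val_three]
  norm_num

/-- **Summary for the stub's statement**: the instance `K = 3`, `N = 4` (data as in the module docstring)
of the sum in `stub_binomialNewtonTauCommon` is the single monomial `2·X^{(3,3)}` — so it has
at most one Newton vertex (consistent with the stub, of course), while its only surviving exponent is at
letter distance `K` from the corner word: the dissociated letter-thickness `< K` does not survive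
coinciding subset sums. [folklore] -/
theorem vert_coincidenceDepth_le_one :
    vert (∑ l : Fin 3, C ((![1, 1, -2] : Fin 3 → ℂ) l) * ∏ j : Fin 4,
        (1 - C ((![![0, -2, 1, 0], ![-2, -1, 0, -2], ![-1, -1, 0, -1]] : Fin 3 → Fin 4 → ℂ) l j)
          * monomial ((![Finsupp.single 0 1, Finsupp.single 0 1 + Finsupp.single 1 1,
      Finsupp.single 0 1 + Finsupp.single 1 1, Finsupp.single 0 1 + Finsupp.single 1 2] : Fin 4 → (Fin 2 →₀ ℕ)) j) (1 : ℂ))) ≤ 1 := by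
  rw [coincidenceDepth_sum_eq]
  exact (vert_le_card_support _).trans ((Finset.card_le_card support_monomial_subset).trans (by simp))

end CoincidenceDepth

end Summit.ValiantsHypothesis.ValiantsHypothesis.Theorems.NewtonUnitEquationsNewtonTauWeak

end
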